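import Summits.QuantumFields.YangMills.Theorems.AlphaInputsT3ACv3TubeFieldModel
import Summits.QuantumFields.YangMills.Theorems.AlphaInputsT3ACv3RegionSection
import Summits.QuantumFields.Balaban3D.Proofs.TorusLift
import HarnessLib

/-!
# `AlphaInputsT3ACv3SectionChart` — START v3 for the (FL) `hLift` binder, row (S5), part 1: **THE ITERATED SECTION, POINTWISE, AND ITS CHART AT AN EDGE** — `iterSec k W ⟨x, κ⟩ = W ⟨coarsen k x, κ⟩`
# if `x` is the LAST site of its level-`k` cell in direction `κ` (`x_κ ≡ L^k − 1 (mod L^k)`) and `1` otherwise; in the model-box chart centred at the corner site of a coarse plaquette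
# `P = (y; μ, ν)` the section IS the model section `modelSec μ ν V(y,μ) V(y+e_μ,ν) V(y+e_ν,μ) V(y,ν)` of row (S2) — lane `pub-balaban3d` ∕ cell `ym3-torus`, seat `ym-ust-19936-w1` (g2, LEAD)

WHY (memo v3 `HOME/ym-ust-19936-w1/NONABELIAN-FL-START-w1-g2.md` §3; OWNER RULING 19936 (FL) START 02:16:33Z, rows (S2)+(S5) → LEAD).  Row (S2) (`…v3TubeFieldModel`) builds the tube on
the model box around the MODEL section; this file identifies the tree's section `BlockAveragingSectionAction.iterSec k V` with that model section in the chart `ModelBox.boxSite c_P` at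
the corner site `c_P` of an interior coarse plaquette, so that the tube can be grafted into the torus (part 2) and its plaquettes read through `ModelBox.plaqHol_boxSite`.
WHAT IS HERE: §1 ★ `iterSec_apply` — the closed form of the `k`-fold section (induction over `faceSec`, with the digit identity `n mod L^{k+1} = L^{k+1} − 1 ⟺ n mod L^k = L^k − 1 ∧
⌊n/L^k⌋ mod L = L − 1`, `mod_mul_eq_pred_iff`); consequences `iterSec_apply_of_last`, `iterSec_apply_of_not_last`; §2 the residue hom `ZMod N₀ → ZMod L^k` reading «last site of
its cell» (`isLast_iff_cast`, `cast_boxSite`), so that box offsets never meet the torus wrap-around; §3 the corner site `cornerSite P` of a coarse plaquette and ★★ `pullB_iterSec_eq_modelSec`: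
for `|u|_∞ ≤ R` with `2R + 2 ≤ L^k` (and `R < (L^k−1)/2` longitudinally), `pullB (cornerSite P) (iterSec k V) u κ = modelSec μ ν (V(y,μ)) (V(y+e_μ,ν)) (V(y+e_ν,μ)) (V(y,ν)) u κ`.
HONEST FRAMING.  Lattice bookkeeping; no estimate; (FL)∕`hLift` NOT proved; count-neutral helper toward R3 2′ (items 19936∕19935); registry untouched; nothing about d = 4, the
continuum, or a mass gap; YM₃ on T³ is rung R3, not Clay.

References: T. Bałaban, Commun. Math. Phys. 102 (1985) 277–309 [Balaban1985Variational] ((11)–(14) pp.279–280); Commun. Math. Phys. 109 (1987) 249–301 [Balaban1987RG1] ((0.1),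
(0.3) pp.251–252).
-/

set_option autoImplicit false

noncomputable section

namespace Summit.QuantumFields.YangMills.Theorems.TubeStart

open Literature.MathematicalPhysics.QuantumFieldTheory.Balaban1983to89
open Literature.MathematicalPhysics.QuantumFieldTheory.Balaban1983to89.BlockAveragingSection (faceSec ExitsBlock faceSec_of_exits faceSec_of_not_exits)
open Literature.MathematicalPhysics.QuantumFieldTheory.Balaban1983to89.BlockAveragingSectionAction (iterSec)
open Summit.QuantumFields.Balaban3D.Carriers
open Summit.QuantumFields.YangMills.Theorems.ModelBox

/-! ## §1 The iterated section, pointwise -/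

section IterSec

/-- **THE DIGIT IDENTITY**: for `0 < m`, `0 < L`: `n mod (m·L) = m·L − 1 ⟺ n mod m = m − 1 ∧ ⌊n/m⌋ mod L = L − 1`. [folklore] -/
theorem mod_mul_eq_pred_iff {n m L : ℕ} (hm : 0 < m) (hL : 0 < L) :
    n % (m * L) = m * L - 1 ↔ n % m = m - 1 ∧ (n / m) % L = L - 1 := by
  have key : n % (m * L) = n % m + m * (n / m % L) := Nat.mod_mul
  have hr : n % m < m := Nat.mod_lt _ hm
  have hq : n / m % L < L := Nat.mod_lt _ hL
  have hmL : m ≤ m * L := Nat.le_mul_of_pos_right _ hL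
  constructor
  · intro h
    rw [key] at h
    -- `r + m q = mL − 1` with `r ≤ m − 1`, `q ≤ L − 1` forces both maxima
    have h1 : m * (n / m % L) ≤ m * (L - 1) := Nat.mul_le_mul_left _ (by omega)
    have h2 : m * (L - 1) = m * L - m := Nat.mul_sub_one m L
    constructor
    · omega
    · have h3 : m * (L - 1) ≤ m * (n / m % L) := by
        by_contra hlt
        push Not at hlt
        have : m * (n / m % L) + m ≤ m * (L - 1) := by
          have := Nat.lt_iff_add_one_le.mp hlt
          calc m * (n / m % L) + m = m * (n / m % L + 1) := by ring
            _ ≤ m * (L - 1) := Nat.mul_le_mul_left _ (by omega)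
        omega
      have h4 : n / m % L = L - 1 := by
        have := le_antisymm h1 h3
        exact Nat.eq_of_mul_eq_mul_left hm this.symm ▸ rfl
      exact h4
  · rintro ⟨h1, h2⟩
    rw [key, h1, h2, Nat.mul_sub_one]
    omega

variable {P : Params} {G : Type*} [GaugeGroup G]

/-- **★ THE ITERATED SECTION, POINTWISE** (`k ≤ m + K`): `iterSec k W ⟨x, κ⟩` is `W ⟨coarsen k x, κ⟩` if `x` is the last site of its level-`k` cell in direction `κ`
(`x_κ mod L^k = L^k − 1`) and `1` otherwise. [cite: Balaban1985Variational, (11) p.279; Balaban1987RG1, (0.3) p.252] -/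
theorem iterSec_apply : ∀ (k : ℕ), k ≤ P.m + P.K → ∀ (W : GaugeField P k G) (x : Site P 0) (κ : Fin P.d),
    iterSec k W ⟨x, κ⟩ = if (x κ).val % P.L ^ k = P.L ^ k - 1 then W ⟨coarsen k x, κ⟩ else 1
  | 0, _, W, x, κ => by
    simp [iterSec, coarsen, Nat.mod_one]
  | k + 1, hk, W, x, κ => by
    have hL : 0 < P.L := by have := P.hL.2; omega
    have hLk : 0 < P.L ^ k := pow_pos hL k
    show iterSec k (faceSec W) ⟨x, κ⟩ = _
    rw [iterSec_apply k (by omega) (faceSec W) x κ]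
    have hval : ((coarsen k x) κ).val = (x κ).val / P.L ^ k := Summit.QuantumFields.Balaban3D.Proofs.TorusLift.val_coarsen k (by omega) x κ
    have hdigit := mod_mul_eq_pred_iff (n := (x κ).val) hLk hL
    rw [← pow_succ] at hdigit
    by_cases h : (x κ).val % P.L ^ (k + 1) = P.L ^ (k + 1) - 1
    · obtain ⟨h1, h2⟩ := hdigit.mp h
      rw [if_pos h, if_pos h1, faceSec_of_exits]
      · rfl
      · show ((coarsen k x) κ).val % P.L = P.L - 1
        rw [hval]; exact h2
    · rw [if_neg h]
      by_cases h1 : (x κ).val % P.L ^ k = P.L ^ k - 1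
      · rw [if_pos h1, faceSec_of_not_exits]
        show ¬ ((coarsen k x) κ).val % P.L = P.L - 1
        rw [hval]
        exact fun h2 => h (hdigit.mpr ⟨h1, h2⟩)
      · rw [if_neg h1]

/-- On a last site the section reads the coarse bond variable. [cite: Balaban1985Variational, (11) p.279] -/
theorem iterSec_apply_of_last {k : ℕ} (hk : k ≤ P.m + P.K) (W : GaugeField P k G) (x : Site P 0) (κ : Fin P.d)
    (h : (x κ).val % P.L ^ k = P.L ^ k - 1) : iterSec k W ⟨x, κ⟩ = W ⟨coarsen k x, κ⟩ := by
  rw [iterSec_apply k hk, if_pos h]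

/-- Off the last sites the section is trivial. [cite: Balaban1985Variational, (11) p.279] -/
theorem iterSec_apply_of_not_last {k : ℕ} (hk : k ≤ P.m + P.K) (W : GaugeField P k G) (x : Site P 0) (κ : Fin P.d)
    (h : ¬ (x κ).val % P.L ^ k = P.L ^ k - 1) : iterSec k W ⟨x, κ⟩ = 1 := by
  rw [iterSec_apply k hk, if_neg h]

end IterSec

/-! ## §2 Reading residues and cell labels of an explicitly presented fine coordinate -/

section Residues

variable {P : Params}

/-- `L^k` is odd: `L^k = 2·⌊L^k/2⌋ + 1`. [cite: Balaban1987RG1, (0.1) p.251] -/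
theorem pow_eq_two_mul_half_add_one (k : ℕ) : P.L ^ k = 2 * (P.L ^ k / 2) + 1 := by
  obtain ⟨r, hr⟩ := (P.hL.1.pow : Odd (P.L ^ k))
  omega

/-- **RESIDUE AND CELL LABEL OF A PRESENTED COORDINATE** (`k ≤ m + K`): if a fine coordinate is `q·L^k + s` with `s < L^k` (as an element of `ZMod N₀`, `N₀ = L^k·n_c`), its
position in its level-`k` cell is `s` and its cell label is `q mod n_c` — the torus wrap-around is absorbed by `q mod n_c`. [cite: Balaban1987RG1, (0.1)+(0.3) pp.251–252] -/
theorem val_mod_div_of_eq_cast {k : ℕ} (hk : k ≤ P.m + P.K) {x : ZMod (P.sitesPerDir 0)} {q s : ℕ} (hs : s < P.L ^ k)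
    (hx : x = ((q * P.L ^ k + s : ℕ) : ZMod (P.sitesPerDir 0))) :
    x.val % P.L ^ k = s ∧ x.val / P.L ^ k % P.sitesPerDir k = q % P.sitesPerDir k := by
  have hm : 0 < P.L ^ k := pow_pos (by have := P.hL.2; omega) k
  -- the finest period is `L^k` times the level-`k` period (= `Prop7FlatCoercivity.sitesPerDir_zero_eq_pow_mul`, inlined to keep the imports light)
  have hN : P.sitesPerDir 0 = P.L ^ k * P.sitesPerDir k := by
    unfold Params.sitesPerDir
    have h : P.m + P.K - 0 = k + (P.m + P.K - k) := by omega
    rw [h, pow_add]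
    ring
  have hval : x.val = (q * P.L ^ k + s) % (P.L ^ k * P.sitesPerDir k) := by
    rw [hx, ZMod.val_natCast, hN]
  have hdecomp : (q * P.L ^ k + s) % (P.L ^ k * P.sitesPerDir k) = s + P.L ^ k * (q % P.sitesPerDir k) := by
    rw [Nat.mod_mul]
    have h1 : (q * P.L ^ k + s) % P.L ^ k = s := by
      rw [Nat.mul_comm, Nat.mul_add_mod, Nat.mod_eq_of_lt hs]
    have h2 : (q * P.L ^ k + s) / P.L ^ k = q := by
      rw [Nat.mul_comm, Nat.mul_add_div hm, Nat.div_eq_of_lt hs, add_zero]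
    rw [h1, h2]
  rw [hval, hdecomp]
  constructor
  · rw [Nat.add_mul_mod_self_left, Nat.mod_eq_of_lt hs]
  · rw [Nat.add_mul_div_left _ _ hm, Nat.div_eq_of_lt hs, zero_add, Nat.mod_mod]

/-- **THE CELL COORDINATE OF A PRESENTED FINE COORDINATE**: `(coarsen k x)_i = q` in `ZMod n_c`. [cite: Balaban1987RG1, (0.3) p.252] -/
theorem coarsen_apply_of_eq_cast {k : ℕ} (hk : k ≤ P.m + P.K) (x : Site P 0) (i : Fin P.d) {q s : ℕ} (hs : s < P.L ^ k)
    (hx : x i = ((q * P.L ^ k + s : ℕ) : ZMod (P.sitesPerDir 0))) :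
    (coarsen k x) i = (q : ZMod (P.sitesPerDir k)) := by
  have hv : ((coarsen k x) i).val = (x i).val / P.L ^ k := Summit.QuantumFields.Balaban3D.Proofs.TorusLift.val_coarsen k hk x i
  have h2 := (val_mod_div_of_eq_cast hk hs hx).2
  rw [← ZMod.natCast_zmod_val ((coarsen k x) i), hv, ← ZMod.natCast_mod, h2, ZMod.natCast_mod]

end Residues

/-! ## §3 The corner site of a coarse plaquette and the section in its chart -/

section Corner

variable {P : Params}

/-- **THE CORNER SITE** of the coarse plaquette `(y; μ, ν)`: the fine site in the cell of `y` that is LAST in the directions `μ, ν` (position `2⌊L^k/2⌋ = L^k − 1`) and CENTRAL (position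
`⌊L^k/2⌋`) in every other direction — the source of the corner-line plaquette at mid-height. [cite: Balaban1985Variational, (11) p.279] -/
def cornerSite (k : ℕ) (y : Site P k) (μ ν : Fin P.d) : Site P 0 := fun i =>
  (((y i).val * P.L ^ k + (if i = μ ∨ i = ν then 2 * (P.L ^ k / 2) else P.L ^ k / 2) : ℕ) : ZMod (P.sitesPerDir 0))

/-- The corner site, transverse coordinate. [folklore] -/
theorem cornerSite_apply_of_mem (k : ℕ) (y : Site P k) {μ ν i : Fin P.d} (hi : i = μ ∨ i = ν) :
    cornerSite k y μ ν i = (((y i).val * P.L ^ k + 2 * (P.L ^ k / 2) : ℕ) : ZMod (P.sitesPerDir 0)) := by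
  simp only [cornerSite, if_pos hi]

/-- The corner site, longitudinal coordinate. [folklore] -/
theorem cornerSite_apply_of_not_mem (k : ℕ) (y : Site P k) {μ ν i : Fin P.d} (hi : ¬ (i = μ ∨ i = ν)) :
    cornerSite k y μ ν i = (((y i).val * P.L ^ k + P.L ^ k / 2 : ℕ) : ZMod (P.sitesPerDir 0)) := by
  simp only [cornerSite, if_neg hi]

/-- `(a : ZMod N) + (t : ZMod N) = (n : ZMod N)` when `a + t = n` over `ℤ`. [folklore] -/
theorem natCast_add_intCast_eq {N a n : ℕ} {t : ℤ} (h : (a : ℤ) + t = (n : ℤ)) :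
    ((a : ℕ) : ZMod N) + ((t : ℤ) : ZMod N) = ((n : ℕ) : ZMod N) := by
  rw [← Int.cast_natCast (R := ZMod N) a, ← Int.cast_add, h, Int.cast_natCast]

variable {k : ℕ} (hk : k ≤ P.m + P.K) (y : Site P k) (μ ν : Fin P.d) {R : ℕ} {u : Fin P.d → ℤ} (hu : InBox R u)
  (hRt : R + 2 ≤ P.L ^ k) (hRl : R + 1 ≤ P.L ^ k / 2)
include hk hu hRt hRl

omit hk hRt in
/-- **TRANSVERSE COORDINATE, NON-POSITIVE OFFSET**: position `L^k − 1 + u_i` in cell `y_i` (`i ∈ {μ, ν}`, `u_i ≤ 0`). [cite: Balaban1987RG1, (0.3) p.252] -/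
theorem corner_transverse_le {i : Fin P.d} (hi : i = μ ∨ i = ν) (hui : u i ≤ 0) :
    ∃ s : ℕ, (s : ℤ) = ((2 * (P.L ^ k / 2) : ℕ) : ℤ) + u i ∧ s < P.L ^ k ∧
      boxSite (cornerSite k y μ ν) u i = (((y i).val * P.L ^ k + s : ℕ) : ZMod (P.sitesPerDir 0)) := by
  obtain ⟨h1, h2⟩ := hu.bounds i
  have hodd := pow_eq_two_mul_half_add_one (P := P) k
  obtain ⟨s, hs⟩ := Int.eq_ofNat_of_zero_le (show (0 : ℤ) ≤ ((2 * (P.L ^ k / 2) : ℕ) : ℤ) + u i by omega)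
  refine ⟨s, hs.symm, by omega, ?_⟩
  show cornerSite k y μ ν i + ((u i : ℤ) : ZMod (P.sitesPerDir 0)) = _
  rw [cornerSite_apply_of_mem k y hi]
  exact natCast_add_intCast_eq (by push_cast [Nat.cast_add] at hs ⊢; omega)

omit hk hRl in
/-- **TRANSVERSE COORDINATE, POSITIVE OFFSET**: position `u_i − 1` in cell `y_i + 1` (`i ∈ {μ, ν}`, `1 ≤ u_i`). [cite: Balaban1987RG1, (0.3) p.252] -/
theorem corner_transverse_pos {i : Fin P.d} (hi : i = μ ∨ i = ν) (hui : 1 ≤ u i) :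
    ∃ s : ℕ, (s : ℤ) = u i - 1 ∧ s + 1 < P.L ^ k ∧
      boxSite (cornerSite k y μ ν) u i = ((((y i).val + 1) * P.L ^ k + s : ℕ) : ZMod (P.sitesPerDir 0)) := by
  obtain ⟨h1, h2⟩ := hu.bounds i
  have hodd := pow_eq_two_mul_half_add_one (P := P) k
  obtain ⟨s, hs⟩ := Int.eq_ofNat_of_zero_le (show (0 : ℤ) ≤ u i - 1 by omega)
  refine ⟨s, hs.symm, by omega, ?_⟩
  show cornerSite k y μ ν i + ((u i : ℤ) : ZMod (P.sitesPerDir 0)) = _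
  rw [cornerSite_apply_of_mem k y hi]
  refine natCast_add_intCast_eq ?_
  have e1 : (((y i).val * P.L ^ k + 2 * (P.L ^ k / 2) : ℕ) : ℤ) = ((y i).val * P.L ^ k : ℕ) + ((2 * (P.L ^ k / 2) : ℕ) : ℤ) := by
    push_cast [Nat.cast_add]; ring
  have e2 : ((((y i).val + 1) * P.L ^ k + s : ℕ) : ℤ) = ((y i).val * P.L ^ k : ℕ) + ((P.L ^ k : ℕ) : ℤ) + (s : ℤ) := by
    push_cast [Nat.cast_add, Nat.cast_mul]; ring
  rw [e1, e2]
  omega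

omit hk hRt in
/-- **LONGITUDINAL COORDINATE**: position `⌊L^k/2⌋ + u_i` in cell `y_i`, never the last one (`i ∉ {μ, ν}`). [cite: Balaban1987RG1, (0.3) p.252] -/
theorem corner_longitudinal {i : Fin P.d} (hi : ¬ (i = μ ∨ i = ν)) :
    ∃ s : ℕ, (s : ℤ) = ((P.L ^ k / 2 : ℕ) : ℤ) + u i ∧ s + 1 < P.L ^ k ∧
      boxSite (cornerSite k y μ ν) u i = (((y i).val * P.L ^ k + s : ℕ) : ZMod (P.sitesPerDir 0)) := by
  obtain ⟨h1, h2⟩ := hu.bounds i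
  have hodd := pow_eq_two_mul_half_add_one (P := P) k
  obtain ⟨s, hs⟩ := Int.eq_ofNat_of_zero_le (show (0 : ℤ) ≤ ((P.L ^ k / 2 : ℕ) : ℤ) + u i by omega)
  refine ⟨s, hs.symm, by omega, ?_⟩
  show cornerSite k y μ ν i + ((u i : ℤ) : ZMod (P.sitesPerDir 0)) = _
  rw [cornerSite_apply_of_not_mem k y hi]
  refine natCast_add_intCast_eq ?_
  have e1 : (((y i).val * P.L ^ k + P.L ^ k / 2 : ℕ) : ℤ) = ((y i).val * P.L ^ k : ℕ) + ((P.L ^ k / 2 : ℕ) : ℤ) := by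
    push_cast [Nat.cast_add]; ring
  have e2 : (((y i).val * P.L ^ k + s : ℕ) : ℤ) = ((y i).val * P.L ^ k : ℕ) + (s : ℤ) := by
    push_cast [Nat.cast_add]; ring
  rw [e1, e2]
  omega

/-- **WHICH CHART POINTS ARE LAST IN THEIR CELL**: in the chart at the corner, `(c + u)_i` is the last site of its cell in direction `i` iff `i ∈ {μ, ν}` and `u_i = 0`.
[cite: Balaban1987RG1, (0.3) p.252] -/
theorem isLast_boxSite_cornerSite_iff (i : Fin P.d) :
    (boxSite (cornerSite k y μ ν) u i).val % P.L ^ k = P.L ^ k - 1 ↔ (i = μ ∨ i = ν) ∧ u i = 0 := by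
  have hodd := pow_eq_two_mul_half_add_one (P := P) k
  by_cases hi : i = μ ∨ i = ν
  · by_cases hui : u i ≤ 0
    · obtain ⟨s, hs, hsm, hx⟩ := corner_transverse_le y μ ν hu hRl hi hui
      rw [(val_mod_div_of_eq_cast hk hsm hx).1]
      constructor
      · intro h; exact ⟨hi, by omega⟩
      · rintro ⟨-, h0⟩; omega
    · obtain ⟨s, hs, hsm, hx⟩ := corner_transverse_pos y μ ν hu hRt hi (by omega)
      rw [(val_mod_div_of_eq_cast hk (by omega) hx).1]
      constructor
      · intro h; omega
      · rintro ⟨-, h0⟩; omega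
  · obtain ⟨s, hs, hsm, hx⟩ := corner_longitudinal y μ ν hu hRl hi
    rw [(val_mod_div_of_eq_cast hk (by omega) hx).1]
    constructor
    · intro h; omega
    · rintro ⟨h, -⟩; exact absurd h hi

/-- **THE CELL OF A CHART POINT**: `coarsen k (c + u)` is `y`, moved by `e_i` exactly in the transverse directions `i` with `u_i ≥ 1`. [cite: Balaban1987RG1, (0.3) p.252] -/
theorem coarsen_boxSite_cornerSite_apply (i : Fin P.d) :
    (coarsen k (boxSite (cornerSite k y μ ν) u)) i =
      if (i = μ ∨ i = ν) ∧ 1 ≤ u i then y i + 1 else y i := by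
  by_cases hi : i = μ ∨ i = ν
  · by_cases hui : 1 ≤ u i
    · obtain ⟨s, hs, hsm, hx⟩ := corner_transverse_pos y μ ν hu hRt hi hui
      rw [if_pos ⟨hi, hui⟩, coarsen_apply_of_eq_cast hk _ i (by omega) hx]
      push_cast
      rw [ZMod.natCast_zmod_val]
    · obtain ⟨s, hs, hsm, hx⟩ := corner_transverse_le y μ ν hu hRl hi (by omega)
      rw [if_neg (fun h => hui h.2), coarsen_apply_of_eq_cast hk _ i hsm hx, ZMod.natCast_zmod_val]
  · obtain ⟨s, hs, hsm, hx⟩ := corner_longitudinal y μ ν hu hRl hi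
    rw [if_neg (fun h => hi h.1), coarsen_apply_of_eq_cast hk _ i (by omega) hx, ZMod.natCast_zmod_val]

/-- The cell of a chart point with `u_μ ≤ 0`: `y` or `y + e_ν`. [cite: Balaban1987RG1, (0.3) p.252] -/
theorem coarsen_boxSite_cornerSite_of_le (hμ : u μ ≤ 0) :
    coarsen k (boxSite (cornerSite k y μ ν) u) = if 1 ≤ u ν then y.shift ν else y := by
  funext i
  rw [coarsen_boxSite_cornerSite_apply hk y μ ν hu hRt hRl i]
  by_cases hν1 : 1 ≤ u ν
  · rw [if_pos hν1]
    by_cases hiν : i = ν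
    · subst hiν
      rw [if_pos ⟨Or.inr rfl, hν1⟩]
      simp [Site.shift]
    · have hc : ¬ ((i = μ ∨ i = ν) ∧ 1 ≤ u i) := by
        rintro ⟨hi | hi, h1⟩
        · rw [hi] at h1; omega
        · exact hiν hi
      rw [if_neg hc]
      simp [Site.shift, Function.update_of_ne hiν]
  · rw [if_neg hν1]
    have hc : ¬ ((i = μ ∨ i = ν) ∧ 1 ≤ u i) := by
      rintro ⟨hi | hi, h1⟩
      · rw [hi] at h1; omega
      · rw [hi] at h1; omega
    rw [if_neg hc]

/-- The cell of a chart point with `u_ν ≤ 0`: `y` or `y + e_μ`. [cite: Balaban1987RG1, (0.3) p.252] -/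
theorem coarsen_boxSite_cornerSite_of_le' (hν : u ν ≤ 0) :
    coarsen k (boxSite (cornerSite k y μ ν) u) = if 1 ≤ u μ then y.shift μ else y := by
  funext i
  rw [coarsen_boxSite_cornerSite_apply hk y μ ν hu hRt hRl i]
  by_cases hμ1 : 1 ≤ u μ
  · rw [if_pos hμ1]
    by_cases hiμ : i = μ
    · subst hiμ
      rw [if_pos ⟨Or.inl rfl, hμ1⟩]
      simp [Site.shift]
    · have hc : ¬ ((i = μ ∨ i = ν) ∧ 1 ≤ u i) := by
        rintro ⟨hi | hi, h1⟩
        · exact hiμ hi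
        · rw [hi] at h1; omega
      rw [if_neg hc]
      simp [Site.shift, Function.update_of_ne hiμ]
  · rw [if_neg hμ1]
    have hc : ¬ ((i = μ ∨ i = ν) ∧ 1 ≤ u i) := by
      rintro ⟨hi | hi, h1⟩
      · rw [hi] at h1; omega
      · rw [hi] at h1; omega
    rw [if_neg hc]

/-- **★★ THE SECTION IN THE CHART AT THE CORNER IS THE MODEL SECTION** (`k ≤ m + K`, `μ ≠ ν`, `|u|_∞ ≤ R`, `R + 2 ≤ L^k`, `R + 1 ≤ ⌊L^k/2⌋`):
`pullB (cornerSite k y μ ν) (iterSec k V) u κ = modelSec μ ν V(y,μ) V(y+e_μ,ν) V(y+e_ν,μ) V(y,ν) u κ`. [cite: Balaban1985Variational, (11) p.279] -/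
theorem pullB_iterSec_eq_modelSec {n : Type*} [Fintype n] [DecidableEq n] [Nonempty n] (hμν : μ ≠ ν)
    (V : GaugeField P k (Matrix.specialUnitaryGroup n ℂ)) (κ : Fin P.d) :
    pullB (cornerSite k y μ ν) (iterSec k V) u κ =
      modelSec μ ν (V ⟨y, μ⟩) (V ⟨y.shift μ, ν⟩) (V ⟨y.shift ν, μ⟩) (V ⟨y, ν⟩) u κ := by
  rw [pullB_apply, iterSec_apply k hk]
  have hlast := isLast_boxSite_cornerSite_iff hk y μ ν hu hRt hRl κ
  by_cases hκμ : κ = μ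
  · subst hκμ
    rw [modelSec_μ κ ν _ _ _ _ hμν]
    by_cases h0 : u κ = 0
    · rw [if_pos (hlast.mpr ⟨Or.inl rfl, h0⟩), if_pos h0, coarsen_boxSite_cornerSite_of_le hk y κ ν hu hRt hRl (by omega)]
      by_cases hν : u ν ≤ 0
      · rw [if_neg (by omega), if_pos hν]
      · rw [if_pos (by omega), if_neg hν]
    · rw [if_neg (fun h => h0 (hlast.mp h).2), if_neg h0]
  · by_cases hκν : κ = ν
    · subst hκν
      rw [modelSec_ν μ κ _ _ _ _ hμν]
      by_cases h0 : u κ = 0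
      · rw [if_pos (hlast.mpr ⟨Or.inr rfl, h0⟩), if_pos h0, coarsen_boxSite_cornerSite_of_le' hk y μ κ hu hRt hRl (by omega)]
        by_cases hμ : u μ ≤ 0
        · rw [if_neg (by omega), if_pos hμ]
        · rw [if_pos (by omega), if_neg hμ]
      · rw [if_neg (fun h => h0 (hlast.mp h).2), if_neg h0]
    · rw [modelSec_of_ne μ ν _ _ _ _ hκμ hκν, if_neg (fun h => by rcases (hlast.mp h).1 with h' | h' <;> contradiction)]

end Corner

end Summit.QuantumFields.YangMills.Theorems.TubeStart

end
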